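import Summits.CriticalPhenomena.PercolationContinuityZ3.Theorems.PercNearOneGluingNoHeavyQuantIndepLegsFar
import HarnessLib

/-!
# QUANT lane R8: the RANK form of the high-marginal small-ball bound for independent legs (spiders)

builds on p205010 (kernel theorem, internal audit signed; external expert review pending)

Support file (`--supports stmt-CriticalPhenomena-4575`), QUANT lane seat prim-quant-census-1 (gen 6); companion of
`PercNearOneGluingNoHeavyQuantIndepLegsFar.lean` (p217240).  Memo: `run/shared/lean/prim/quant/CENSUS-GAIN.md` §14,
`P1-SURPLUS.md` §13.1 (p1 g3's conjecture FAR-RANK: `E N > 2j ⟹ P(N ≥ j+1) ≥ q_(2j+1)`, `q_(k)` the k-th largest marginal).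
Theorems only; no definitions, no sorries, standard axioms.

Setting as in p217240 (gate coordinates of a spider: gates `ι`, `leg : ι → J`, `depth : ι → ℕ`, the relay below `x` is reached iff
every gate `y` with `leg y = leg x ∧ depth y ≤ depth x` is open; `T x = ∏ p` over that prefix; `N(ω)` = number of reached relays).

* `Quant.indepLegs_rank_smallBall` — **if some `2j+1` relays `B` all have marginal `≥ 1 − t ≥ 1/2`, then `P(N ≤ j) ≤ t`** — no mean
  hypothesis and no condition on the other relays.  With `t = 1 − q_(2j+1)` this is FAR-RANK for spiders whenever `q_(2j+1) ≥ 1/2`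
  (and it does not even need `E N > 2j` there).  Proof = p217240's top-blob domination restricted to `B`: `N ≥ Σ_j #(B ∩ leg j)·1[leg j open
  down to its deepest B-relay]`, the readings are product Bernoulli on `J` (block principle) with gates `≥ 1 − t`, and p2's
  `Quant.halfMean_smallBall_of_card` applies.  The regime `q_(2j+1) < 1/2` of FAR-RANK is NOT covered (there the mean hypothesis is needed
  and Cantelli only yields the `q_min` form `Quant.far_indepLegs`).
[cite: KozmaNitzan2024, Lemma 2 (p. 6), Conjecture 3 (p. 15)]
-/

noncomputable section

namespace Summit.CriticalPhenomena.PercolationContinuityZ3.Theorems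

open MeasureTheory Set Finset
open Literature.Probability.LatticeModels
open scoped Classical

namespace Quant

variable {ι J : Type*} [Fintype ι] [Fintype J]

/-- **Rank form of the high-marginal small-ball bound for independent legs.**  Gates `ι` on legs (`leg`, `depth`), independent with
parameters `p`; if a set `B` of at least `2j+1` relays has every marginal `∏_{prefix} p ≥ 1 − t` with `t ≤ 1/2`, then
`P(#{x | prefix of x open} ≤ j) ≤ t` — FAR-RANK for spiders in the regime `q_(2j+1) ≥ 1/2`, with no hypothesis on the mean or on the
relays outside `B`. [this work] -/
theorem indepLegs_rank_smallBall (leg : ι → J) (depth : ι → ℕ) (p : ι → unitInterval) (B : Finset ι) (j : ℕ) (t : ℝ)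
    (ht2 : t ≤ 1 / 2) (hB : 2 * j + 1 ≤ B.card)
    (ht : ∀ x ∈ B, 1 - ∏ y ∈ univ.filter (fun y => leg y = leg x ∧ depth y ≤ depth x), (p y : ℝ) ≤ t) :
    (prodBernoulli p).real {ω : Set ι |
      (univ.filter (fun x => ((univ.filter (fun y => leg y = leg x ∧ depth y ≤ depth x) : Finset ι) : Set ι) ⊆ ω)).card ≤ j} ≤ t := by
  set μ := prodBernoulli p with hμ
  set P : ι → Finset ι := fun x => univ.filter (fun y => leg y = leg x ∧ depth y ≤ depth x) with hP
  set E : Set (Set ι) := {ω : Set ι | (univ.filter (fun x => ((P x : Finset ι) : Set ι) ⊆ ω)).card ≤ j} with hE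
  have hp0 : ∀ i, (0 : ℝ) ≤ p i := fun i => (p i).2.1
  have hp1 : ∀ i, (p i : ℝ) ≤ 1 := fun i => (p i).2.2
  -- `B` is nonempty, hence `0 ≤ t`
  have hBne : B.Nonempty := Finset.card_pos.1 (by omega)
  obtain ⟨x₀, hx₀⟩ := hBne
  have hT1x : ∏ y ∈ P x₀, (p y : ℝ) ≤ 1 := Finset.prod_le_one (fun y _ => hp0 y) fun y _ => hp1 y
  have ht0 : 0 ≤ t := by linarith [ht x₀ hx₀]
  -- truncated fibres: the gates of leg `j'` down to its deepest `B`-relay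
  set F : J → Finset ι := fun j' => univ.filter (fun y => leg y = j' ∧ ∃ x ∈ B, leg x = j' ∧ depth y ≤ depth x) with hF
  set a : J → ℕ := fun j' => (B.filter (fun x => leg x = j')).card with ha
  -- every `B`-relay of leg `j'` has its prefix inside `F j'`
  have hPF : ∀ x ∈ B, P x ⊆ F (leg x) := by
    intro x hx y hy
    simp only [hP, Finset.mem_filter, Finset.mem_univ, true_and] at hy
    simp only [hF, Finset.mem_filter, Finset.mem_univ, true_and]
    exact ⟨hy.1, x, hx, rfl, hy.2⟩
  -- a deepest `B`-relay of leg `j'` sees exactly `F j'`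
  have hdeep : ∀ j', (B.filter (fun x => leg x = j')).Nonempty → ∃ x ∈ B, leg x = j' ∧ P x = F j' := by
    intro j' hne
    obtain ⟨x, hx, hmax⟩ := Finset.exists_max_image (B.filter (fun x => leg x = j')) depth hne
    rw [Finset.mem_filter] at hx
    refine ⟨x, hx.1, hx.2, Finset.Subset.antisymm (by rw [← hx.2]; exact hPF x hx.1) fun y hy => ?_⟩
    simp only [hF, Finset.mem_filter, Finset.mem_univ, true_and] at hy
    obtain ⟨hly, x', hx'B, hlx', hyx'⟩ := hy
    have hx'depth : depth x' ≤ depth x := hmax x' (Finset.mem_filter.2 ⟨hx'B, hlx'⟩)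
    simp only [hP, Finset.mem_filter, Finset.mem_univ, true_and]
    exact ⟨hly.trans hx.2.symm, hyx'.trans hx'depth⟩
  -- empty `B`-fibre ⟹ `F j' = ∅`
  have hFempty : ∀ j', ¬ (B.filter (fun x => leg x = j')).Nonempty → F j' = ∅ := by
    intro j' hne
    rw [Finset.not_nonempty_iff_eq_empty, Finset.filter_eq_empty_iff] at hne
    simp only [hF, Finset.filter_eq_empty_iff, Finset.mem_univ, true_implies, not_and, not_exists]
    intro y _ x hx hlx
    exact absurd hlx (hne hx)
  -- the block reading
  set g : J → Set ι → Prop := fun j' ω => ((F j' : Finset ι) : Set ι) ⊆ ω with hg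
  have hloc : IsBlockLocal leg g := by
    intro j' ω ω' hagree
    simp only [hg, Set.subset_def, Finset.mem_coe]
    refine forall_congr' fun e => ?_
    refine imp_congr_right fun he => ?_
    have : leg e = j' := by
      simp only [hF, Finset.mem_filter, Finset.mem_univ, true_and] at he; exact he.1
    exact hagree e this
  have hmeas : ∀ j', Measurable (g j') := fun j' => Measurable.of_discrete
  set q : J → unitInterval := fun j' => ⟨∏ y ∈ F j', (p y : ℝ),
    Finset.prod_nonneg fun y _ => hp0 y, Finset.prod_le_one (fun y _ => hp0 y) fun y _ => hp1 y⟩ with hq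
  have hq' : ∀ j', μ.real {ω | g j' ω} = q j' := fun j' => prodBernoulli_real_subset p (F j')
  have hqt : ∀ j', 1 - (q j' : ℝ) ≤ t := by
    intro j'
    by_cases hne : (B.filter (fun x => leg x = j')).Nonempty
    · obtain ⟨x, hxB, -, hx⟩ := hdeep j' hne
      have : (q j' : ℝ) = ∏ y ∈ P x, (p y : ℝ) := by simp only [hq]; rw [hx]
      rw [this]; exact ht x hxB
    · have h0 := hFempty j' hne
      have : (q j' : ℝ) = 1 := by simp [hq, h0]
      rw [this]; linarith
  -- total truncated mass = `|B| ≥ 2j+1`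
  have hT : 2 * j + 1 ≤ ∑ j', a j' := by
    have : B.card = ∑ j', a j' := Finset.card_eq_sum_card_fiberwise fun x _ => Finset.mem_univ (leg x)
    omega
  set L : Set (Set J) := {S : Set J | ∑ j' ∈ univ.filter (fun j' => j' ∈ S), a j' ≤ j} with hL
  have hsub : E ⊆ (fun ω => {j' | g j' ω}) ⁻¹' L := by
    intro ω hω
    simp only [Set.mem_preimage, hL, Set.mem_setOf_eq]
    have hωE : (univ.filter (fun x => ((P x : Finset ι) : Set ι) ⊆ ω)).card ≤ j := hω
    set S' : Finset J := univ.filter (fun j' => j' ∈ {j'' | g j'' ω}) with hS'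
    have hdisj : ∀ u ∈ S', ∀ v ∈ S', u ≠ v →
        Disjoint (B.filter (fun x => leg x = u)) (B.filter (fun x => leg x = v)) := by
      intro u _ v _ huv
      rw [Finset.disjoint_left]
      intro x hxu hxv
      rw [Finset.mem_filter] at hxu hxv
      exact huv (hxu.2.symm.trans hxv.2)
    have hbi : (S'.biUnion fun j' => B.filter (fun x => leg x = j')).card = ∑ j' ∈ S', a j' :=
      Finset.card_biUnion hdisj
    have hincl : (S'.biUnion fun j' => B.filter (fun x => leg x = j')) ⊆
        univ.filter (fun x => ((P x : Finset ι) : Set ι) ⊆ ω) := by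
      intro x hx
      rw [Finset.mem_biUnion] at hx
      obtain ⟨j', hj', hxj⟩ := hx
      rw [Finset.mem_filter] at hxj
      have hgj : ((F j' : Finset ι) : Set ι) ⊆ ω := by
        have : j' ∈ {j'' | g j'' ω} := by simpa [hS'] using hj'
        exact this
      simp only [Finset.mem_filter, Finset.mem_univ, true_and]
      intro y hy
      have hy' : y ∈ F j' := by rw [← hxj.2]; exact hPF x hxj.1 (Finset.mem_coe.1 hy)
      exact hgj (Finset.mem_coe.2 hy')
    calc ∑ j' ∈ S', a j' = (S'.biUnion fun j' => B.filter (fun x => leg x = j')).card := hbi.symm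
      _ ≤ (univ.filter (fun x => ((P x : Finset ι) : Set ι) ⊆ ω)).card := Finset.card_le_card hincl
      _ ≤ j := hωE
  have hpre : μ.real ((fun ω => {j' | g j' ω}) ⁻¹' L) = (prodBernoulli q).real L :=
    prodBernoulli_real_preimage_readBlocks p leg hloc hmeas q hq' MeasurableSet.of_discrete
  calc μ.real E ≤ μ.real ((fun ω => {j' | g j' ω}) ⁻¹' L) := measureReal_mono hsub (measure_ne_top _ _)
    _ = (prodBernoulli q).real L := hpre
    _ ≤ t := halfMean_smallBall_of_card q a j t ht2 hqt hT

end Quant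

end Summit.CriticalPhenomena.PercolationContinuityZ3.Theorems

end
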